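import Summits.QuantumFields.YangMills.Theorems.BalabanUVNodesN18AtRateRecord13Generated
import Summits.QuantumFields.YangMills.Theorems.BalabanUVNodesN18AtReadingOfRecord13CoPH

/-!
# `CoPH` EDITION of this seat's `CoPR` module `BalabanUVNodesN18AtRateRecord13CoPRGenerated`: its image under def-T's token legend for the `CoPH` record (dag-lead WORDS key map of record) — binder
# `Stage13RParams ↦ Stage13HParams`, `Provisos₁₃CoPR ↦ Provisos₁₃CoPH`, guard `ZrUnity ↦ ZhUnity`, names `CoPR ↦ CoPH` (def-T record file p537939, RR-2 key leaf `Node00/Record13DatumKeyCoPH` p539151,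
# dag-n22-e `…13CoPH…` homes); the θ-level ‴ objects stay cited at `….toStage13Params` (parent projections through `extends`).  WHY: director-ym №183 ∕ №185 (FINDING №9 = def-T LOCATED-9 «HISTORY-BLIND residual 𝐓-weight slot: v1.6 `Zr p` is run-indexed but history-blind; print's ζ(Ω^c_{k+1}) [III] p.267 L15–20 ∕ (3.23) p.270 is built from the term's history»; ruling H1ʰ: `structure Stage13HParams extends Stage13RParams` + ONE history-indexed field `Zh`, guard `ZhUnity`, rows `zhLaws ∕ zhLocal`, MAXIMALITY RIDER; one edition, one press, «pens port their OWN files»).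
# Statements = the `CoPR` statements under the map, proofs verbatim; the `CoPR` module STANDS as a landed sibling.  Its header follows, token-mapped.
#
# `CoPR` (RECORD 13 v1.6, FINDING №8) EDITION of `BalabanUVNodesN18AtRateRecord13Generated` (p497977) — seat pub-ymgap-dag-n18-d (N18 = NE5, strategy s2), RE-KEYED on the run-indexed parameter record
# `Stage13RParams` ∕ the proviso binder `Stage13RParams.Provisos₁₃CoPH` ∕ the datum `Node00.datumOfRecord₁₃CoPH` (def-T's FILE 25 `Node00/Record13CoPH`, p529474), RR-2's datum key
# `Node00.IsDatumOfRecord₁₃CCoPH` (`Node00/Record13DatumKeyCoPH`, p531309) and dag-n22-e's (T-RATE) layer-B homes (`RateReading₁₃CoPH`, `RRec₁₃CoPH`, `RRec₁₃CoPHOn`, `readingOfRecord₁₃CoPH`,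
# `s_N18_rRec₁₃CoPH(On)_iff`, `forall_datumKey₁₃CoPH_of_forall_admissible`, `readingOfRecord₁₃CoPH_u3`)
#
# WHY (route `route-QuantumFields-BalabanUVNodes`; dag-lead KEY MAP of record WORDS-142): director-ym №169 (H1, TREE-FIRST) ∕ №174 (PRESS WORD) on def-T's LOCATED-8 = FINDING №8 («the residual 𝐓-weight
# slot `Stage12Params.Zt : (K : ℕ) → TkResidualW … K` is RUN-BLIND; print's ζ(Ω₁ᶜ) [III] (1.11) p.248, (2.4) p.255, (3.16)–(3.20) pp.268–9 reads the RUN»): def-T's FILE 25 `Node00/Record13CoPH` (p529474)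
# introduced `structure Stage13RParams extends Stage13Params` with ONE new run-indexed field `Zr : (p : B12.RunParams) → TkResidualW …`, the guard `ZrUnity`, the proviso core
# `Stage13RParams.Provisos₁₃CoPH` (v1.2's `Provisos₁₃Core` rows at `θ.toStage13Params` + `zrLaws ∕ zrLocal`), the datum `datumOfRecord₁₃CoPH` and the record class `IsRecordOfRecord₁₃CCoPH`
# (+ the one-way run-blind embedding `Stage13RParams.ofRunBlind` of v1.5); RR-2 re-keyed the datum key on it (`Node00/Record13DatumKeyCoPH`, p531309), the (T-RATE) layer B re-keyed its
# homes (dag-n22-e, `…13CoPH…`), plan presses rev 22 (⁶ = T₆(⁵), K3⁶ `SpineGivenEndpointR13SepCoPR`).  A theorem binding `θ : Stage13Params` cannot be applied at a `Stage13RParams` item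
# tuple's datum, so every storey typed `∀ (θ : Stage13Params F N) (hc : θ.Provisos₁₃Core F N), …` is re-keyed ONCE MORE («pens port their OWN files», №174 (3)); the ‴ ∕ `Sep` ∕ `Co` ∕
# `CoP` editions of this module STAND as landed siblings.  THIS FILE is the image of this seat's v1.5 module `BalabanUVNodesN18AtRateRecord13CoPGenerated` (p527876) under def-T's KEY-RULE-25 (= WORDS-142
# legend), token for token: binder `Stage13Params ↦ Stage13RParams` (regimes `Rg`, reading families `W ∕ S ∕ sp ∕ big ∕ gauge ∕ T₀ ∕ li ∕ 𝔇 …` typed over `Stage13RParams`) ·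
# `Provisos₁₃Core ↦ Provisos₁₃CoPH` · names `CoP ↦ CoPR` (`IsDatumOfRecord₁₃CCoP ↦ IsDatumOfRecord₁₃CCoPH`, `RateReading₁₃CoP ↦ RateReading₁₃CoPH`, `RRec₁₃CoP(On) ↦ RRec₁₃CoPH(On)`,
# `readingOfRecord₁₃CoP ↦ readingOfRecord₁₃CoPH`, `forall_datumKey₁₃CoP_… ↦ forall_datumKey₁₃CoPH_…`, this seat's `rRec₁₃CoP… ↦ rRec₁₃CoPH…`, modules `…13CoP… ↦ …13CoPH…`) · SITE-RULE
# (KEY-RULE-25: `X … θ ↦ X … θ.toStage13Params` for every θ-level X NOT re-issued): `u3OfRecord₁₃ θ ↦ u3OfRecord₁₃ θ.toStage13Params` (also at `h.params`), the ‴ per-tuple junctions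
# `n18At_u3OfRecord₁₃_… θ k ↦ … θ.toStage13Params k`, `θ.toStage12Params ↦ θ.toStage13Params.toStage12Params`; `θ.γ ∕ θ.τ9.M ∕ θ.Admissible F N ∕ θ.SlotsNondegenerate₁₃ F N` resolve
# through `extends` unchanged.  Statements = the v1.5 statements under the map, proofs = the v1.5 proofs verbatim.  In the retained v1.5 paragraph below the historical token
# table reads, after the map, `Provisos₁₃ ↦ Provisos₁₃CoPH` ·
# `datumOfRecord₁₃ ↦ datumOfRecord₁₃CoPH` · `IsDatumOfRecord₁₃C ↦ IsDatumOfRecord₁₃CCoPH` · `RateReading₁₃ ↦ RateReading₁₃CoPH` · `RRec₁₃ ↦ RRec₁₃CoPH` · `RRec₁₃On ↦ RRec₁₃CoPHOn` ·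
# `readingOfRecord₁₃ ↦ readingOfRecord₁₃CoPH` · `s_N18_rRec₁₃(On)_iff ↦ s_N18_rRec₁₃CoPH(On)_iff` · `forall_datumKey₁₃_of_forall_admissible ↦ forall_datumKey₁₃CoPH_of_forall_admissible`, and in
# THIS seat's decl names `rRec₁₃ ↦ rRec₁₃CoPH`, `readingOfRecord₁₃ ↦ readingOfRecord₁₃CoPH`; statements = the ‴ statements under the map, proofs = the ‴ proofs VERBATIM.
# EVERYTHING θ-LEVEL IS UNCHANGED AND NOT RE-DECLARED (`Stage13Params`, `u3OfRecord₁₃`, the per-tuple faces and junctions of the original carry no proviso ∕ key and are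
# IMPORTED BY NAME — this module imports its ‴ original) — here: `n18At_u3OfRecord₁₃_readingAdm_toClusterTower_of_stepGen`.
# ITEM IDS quoted in the ‴ header below (K3‴ `SpineGivenEndpointR13`, stmt-QuantumFields-19912; K0‴) are ASIDES; this file is filed as a HELPER on the K3 item of the
# dag-lead KEY MAP of record — COUNT-NEUTRAL, no stub closed, N18 NOT discharged, no inhabitant of any key claimed (K0 OPEN).
#
# ‴ HEADER OF RECORD FOLLOWS (token-mapped; its decl list is this file's, the θ-only names above excepted):
#
# BalabanUVNodes ∕ node N18 = NE5 — THE (GEN) JUNCTION AT THE STAGE-13 HOME: N18 for node00-def-W1's GENERATED towers `toClusterTower (G F θ k)` from dag-n18-c's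
# per-generator schema, at every pinned Stage-13 reading, unguarded and at the regime-restricted home
# (Track A, DAG node N18 = `T4OutputRate.NE5` :211; cluster K4 «SpineRates», item K3‴ `SpineGivenEndpointR13`; module 18c of seat pub-ymgap-dag-n18-d, strategy s2)

HONEST FRAMING.  Count-neutral kernel bookkeeping (`--supports … --as helper`), composition BY NAME of landed theorems; NE5 is NOT PRINTED and NOT proved;
N18 is NOT discharged; no inhabitant of `IsDatumOfRecord₁₃CCoPH` is claimed (K0‴ OPEN); the generators `G` and the schema (GEN) are PARAMETERS ∕ HYPOTHESES.

WHY.  Module 15 (`…N18AtReadingAdmGenerated`, p488577) knitted N18 at the admissible reading for W1's GENERATED towers `S F θ k := toClusterTower (G F θ k)` from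
dag-n18-c g4's per-generator schema (GEN) (`…N18HLayerW1Recursion`, p486412) — keyed ₁₂.  Modules 18 ∕ 18b typed N18's Stage-13 home for any pinned reading with the
UNCONDITIONAL `AnalyticH` ∕ `Bound238` currency.  THIS FILE is the (GEN) currency AT THE STAGE-13 HOME: per tuple and level, module 15 §1's θ-free
`n18At_pairingAdm_toClusterTower_of_stepGen` + `N18AtByName.n18At_mono` + module 18 §1's `Iff.rfl` bundle face (§1); the family rows over the admissible Stage-13 tuples
with `Provisos₁₃CoPH`, unguarded (`RRec₁₃CoPH 𝔯`, module 18's `s_N18_rRec₁₃CoPH_of_forall_admissible_pin`) and at the regime home (`RRec₁₃CoPHOn 𝔯 Rg`, layer B's `s_N18_rRec₁₃CoPHOn_iff`)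
(§2) — what dag-n22-e g5's 8c″ edges and the K3‴ composer's field table consume as the N18 conjunct at the generated reading.

WHAT (all `theorem`, 0 `def`).  §1 ★ `n18At_u3OfRecord₁₃_readingAdm_toClusterTower_of_stepGen` (ONE tuple, ONE level).  §2 ★ `s_N18_rRec₁₃CoPH_readingAdm_toClusterTower_of_stepGen_pin`
(unguarded home), ★ `s_N18_rRec₁₃CoPHOn_readingAdm_toClusterTower_of_stepGen_pin` (regime home).

One finite four-torus programme at fixed `ε`; NOT the continuum limit, NOT OS, NOT a mass gap, NOT Clay.  0 `def`, 0 `sorry`.  Sources (TYPES only): T. Bałaban,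
CMP **109** (1987) [Balaban1987RG1] (0.24)–(0.25) p. 257, Thm 1 p. 259, (1.18) p. 263, (2.12)–(2.13) p. 268; CMP **116** (1988) [Balaban1988RG2Cluster] (1.41) p. 11,
(2.13)–(2.14) pp. 14–15, Lemma 3 (2.38) p. 20; CMP **122** (1989) [Balaban1989LargeFieldII] (the record's stage).
-/

noncomputable section

open Set Metric
open scoped Matrix.Norms.L2Operator

namespace YMDAG.N18.W1Reading

open Literature.MathematicalPhysics.QuantumFieldTheory.Balaban1983to89
open Literature.MathematicalPhysics.QuantumFieldTheory.Balaban1983to89.T4Continuum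
open Literature.MathematicalPhysics.QuantumFieldTheory.Balaban1983to89.T4OutputRate (Carriers Functional NE5 DecayBound Window)
open Literature.MathematicalPhysics.QuantumFieldTheory.Balaban1983to89.T4InputCauchyRateData (StepModel)
open Literature.MathematicalPhysics.QuantumFieldTheory.Balaban1983to89.B13Resummation (locE)
open Literature.MathematicalPhysics.QuantumFieldTheory.Balaban1983to89.TreeLengthTorus (TDom tsys torusTreeLen)
open Literature.MathematicalPhysics.QuantumFieldTheory.Balaban1983to89.TreeLengthTorusGeometry (TTouch)
open Literature.MathematicalPhysics.QuantumFieldTheory.Balaban1983to89.B12TreeDecay (K₀)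
open Literature.MathematicalPhysics.QuantumFieldTheory.Balaban1983to89.Node00 (Stage12Params Stage13Params Stage13RParams Stage13HParams IsDatumOfRecord₁₃CCoPH datumOfRecord₁₃CoPH U3Letters₁₁
  U3Objects₁₁ NE2Objects₁₁ NE3Letters₁₁ prependCoupling MatA ιSU avOfRecord)
open Literature.MathematicalPhysics.QuantumFieldTheory.Balaban1983to89.Node00.Sect2 (domCount domSys CPair ofBackgroundC)
open Literature.MathematicalPhysics.QuantumFieldTheory.Balaban1983to89.Node00.W1 (ReadingData LevelPairing LetterInputs ClusterTower pairOfRecord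
  dj_pairOfRecord functionalC functional termC box SpRestr AdmBg GenTower OlderTerms toClusterTower)
open Summit.QuantumFields.BalabanUV.T4Continuum.B13Carriers (transportRaw)
open Summit.QuantumFields.BalabanUV.T4Continuum.Spine.NE5
open Summit.QuantumFields.YangMills.BalabanUVNodes.N18AtByName (n18At_mono)
open YMDAG.N18.HLayer
open YMDAG.UVSplit

variable {N : ℕ} [NeZero N]

/-! ## §2 The family rows at the Stage-13 homes for generated towers -/

section Record

variable (𝔯 : RateReading₁₃CoPH N) (Rg : (F : T4Family) → Stage13HParams F N → Prop)
  (G : (F : T4Family) → (θ : Stage13HParams F N) → (k : ℕ) → GenTower (F.P k) (MatA N) θ.τ9.M)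
  (D : (F : T4Family) → Stage13HParams F N → ℕ → Set ℂ)
  (sp : (F : T4Family) → (θ : Stage13HParams F N) → (k j : ℕ) → (domSys (F.P k) θ.τ9.M j).Dom → Set (CPair (F.P k) (MatA N)))
  (gauge : (F : T4Family) → (θ : Stage13HParams F N) → (k : ℕ) → GaugeField (F.P k) 0 (Node00.SU N) → GaugeField (F.P k) 0 (Node00.SU N) → ℝ)
  (hg : ∀ (F : T4Family) (θ : Stage13HParams F N) (k : ℕ) (U U' : GaugeField (F.P k) 0 (Node00.SU N)), 0 ≤ gauge F θ k U U')
  (T₀ : (F : T4Family) → (θ : Stage13HParams F N) → (k : ℕ) → GaugeField (F.P (k + 1)) 0 (Node00.SU N) → GaugeField (F.P k) 0 (Node00.SU N))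
  (hT : ∀ (F : T4Family) (θ : Stage13HParams F N) (k : ℕ) (U : GaugeField (F.P (k + 1)) 0 (Node00.SU N)),
    (∀ (j : ℕ) (Y : (domSys (F.P (k + 1)) θ.τ9.M j).Dom), ofBackgroundC (ιSU N) U ∈ sp F θ (k + 1) j Y) →
      ∀ (j : ℕ) (X : (domSys (F.P k) θ.τ9.M j).Dom), ofBackgroundC (ιSU N) (T₀ F θ k U) ∈ sp F θ k j X)
  (li : (F : T4Family) → Stage13HParams F N → LetterInputs)
  (hpin : ∀ (F : T4Family) (θ : Stage13HParams F N) (hP : θ.Provisos₁₃CoPH F N) (g₀ : ℕ → ℝ) (os : List (ULoop F)),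
    (𝔯.lit F θ hP g₀ os).u3 =
      (ReadingData.ofRecordAdm F θ.τ9.M N (fun k => toClusterTower (G F θ k)) (sp F θ) (gauge F θ) (hg F θ) (T₀ F θ) (hT F θ) (li F θ)).u3Objects θ.γ)

include hpin in
open Classical in
/-- ★ **THE (GEN) ROW AT THE STAGE-13 HOME** [bookkeeping; §1 at every admissible Stage-13 tuple with provisos and every run length, module 18's
`s_N18_rRec₁₃CoPH_of_forall_admissible_pin`]: for a reading pinned to the admissible reading family whose towers are GENERATED (`toClusterTower (G F θ k)`; tables `sp F θ`,
transports `T₀ F θ` with clause `hT`, letters `li F θ`, coupling domains `D F θ k`): if at EVERY admissible Stage-13 tuple `θ` with `Provisos₁₃CoPH` and every run length `k`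
there are (i) the END's data over the carriers of the admissible level pairing and (ii) (GEN) for both runs' generators on their tables with the STRICT clauses, renewals and
`]0, γ′] ⊆ D F θ k`, the letters dominating — then `S_N18 (RRec₁₃CoPH 𝔯)`.  The ₁₃ twin of module 15 §2. [cite: Balaban1987RG1, (0.24)–(0.25) p.257, Thm 1 p.259, (1.18) p.263 and (2.12)–(2.13) p.268;
Balaban1988RG2Cluster, (1.41) p.11, (2.13)–(2.14) pp.14–15, Lemma 3 (2.38) p.20] -/
theorem s_N18_rRec₁₃CoPH_readingAdm_toClusterTower_of_stepGen_pin
    (h : ∀ (F : T4Family) (θ : Stage13HParams F N), θ.Provisos₁₃CoPH F N → θ.Admissible F N → ∀ k : ℕ,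
      ∃ (Op : Type) (_ : NormedAddCommGroup Op) (_ : NormedSpace ℂ Op) (Hist : Type) (_ : NormedAddCommGroup Hist) (_ : NormedSpace ℂ Hist)
        (Mb : ℝ → StepModel (LevelPairing.ofRecordAdm F θ.τ9.M N k (sp F θ) (gauge F θ k) (hg F θ k) (T₀ F θ k) (hT F θ k)).carriers Op Hist)
        (act : ℝ → (j : ℕ) → Op × Hist → TDom 4 (domCount (F.P k) θ.τ9.M j) → ℂ) (γ' C3 ε₁ Rd κ A_A A_B E_A E_B E₁ δ δ' θr θ' cH ω ρ₀ B : ℝ)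
        (k₀ : ℕ),
        (∀ b : ℝ, 0 < b → b ≤ γ' → ∀ (X : Node00.W1.Dom (F.P k) θ.τ9.M) (z : Op × Hist),
          (Mb b).Out X.1 z.1 z.2 X =
            locE (TTouch (d := 4) (N := domCount (F.P k) θ.τ9.M X.1)) (fun Z : (tsys 4 (domCount (F.P k) θ.τ9.M X.1)).Dom => Z.1)
              (act b X.1 z) X.2.1) ∧
        0 ≤ C3 ∧ 0 ≤ ε₁ ∧ 0 ≤ κ ∧ κ + 2 * (64 * Real.log 162) + 2 ≤ Rd ∧
        C3 * ε₁ * Real.exp (5 * κ + 1) * K₀ 64 8 * 9 * 64 ≤ 1 ∧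
        (∀ b : ℝ, 0 < b → b ≤ γ' → ∀ j, ∀ g ∈ Window γ',
          ∀ (U : (LevelPairing.ofRecordAdm F θ.τ9.M N k (sp F θ) (gauge F θ k) (hg F θ k) (T₀ F θ k) (hT F θ k)).BgB) (q : Op × Hist),
          q ∈ (Mb b).Base j g U →
          ∃ V : Set (Op × Hist), IsOpen V ∧ (Mb b).box j q ⊆ V ∧
            (∀ Z : TDom 4 (domCount (F.P k) θ.τ9.M j), DifferentiableOn ℂ (fun z : Op × Hist => act b j z Z) V) ∧
            (∀ z ∈ V, ∀ Z : TDom 4 (domCount (F.P k) θ.τ9.M j), ‖act b j z Z‖ ≤ C3 * ε₁ * Real.exp (-(Rd * torusTreeLen Z.1)))) ∧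
        (∀ b : ℝ, 0 < b → b ≤ γ' → L01 (Mb b)
          ((LevelPairing.ofRecordAdm F θ.τ9.M N k (sp F θ) (gauge F θ k) (hg F θ k) (T₀ F θ k) (hT F θ k)).EA (toClusterTower (G F θ k))) (Window γ')) ∧
        (∀ b : ℝ, 0 < b → b ≤ γ' → L02 (Mb b)
          ((LevelPairing.ofRecordAdm F θ.τ9.M N k (sp F θ) (gauge F θ k) (hg F θ k) (T₀ F θ k) (hT F θ k)).EB (toClusterTower (G F θ (k + 1))) b)
          (Window γ')) ∧
        (∀ b : ℝ, 0 < b → b ≤ γ' → L03 (Mb b)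
          ((LevelPairing.ofRecordAdm F θ.τ9.M N k (sp F θ) (gauge F θ k) (hg F θ k) (T₀ F θ k) (hT F θ k)).EB (toClusterTower (G F θ (k + 1))) b)
          (Window γ')) ∧
        (∀ b : ℝ, 0 < b → b ≤ γ' → L07 (Mb b) (Window γ') δ θr) ∧
        (∀ b : ℝ, 0 < b → b ≤ γ' → L08 (Mb b) (Window γ') κ E_B δ' θr) ∧
        (∀ b : ℝ, 0 < b → b ≤ γ' → L09aff (Mb b) (Window γ')) ∧ (∀ b : ℝ, 0 < b → b ≤ γ' → L09blind (Mb b) (Window γ')) ∧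
        (∀ b : ℝ, 0 < b → b ≤ γ' → L09hom (Mb b) (Window γ')) ∧ (∀ b : ℝ, 0 < b → b ≤ γ' → L09unit (Mb b) (Window γ') κ E₁ cH ω) ∧
        0 < E₁ ∧ 0 ≤ δ + δ' ∧ 0 ≤ θr ∧ θr ≤ θ' ∧ θ' ≤ 1 ∧ 0 ≤ cH ∧ 0 < ω ∧ ρ₀ < 1 ∧
        (δ + δ') * θr ^ k₀ + cH * (E_A + E_B) / (1 - ω) ≤ ρ₀ ∧ 0 ≤ B ∧ (∀ k < k₀, E_A + E_B ≤ B * θr ^ k) ∧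
        Real.exp 1 * 9 * 64 * K₀ 64 8 ^ 2 * C3 * cH * ε₁ < (θ' - ω) * (1 - ρ₀) ∧
        (∀ m, SpRestr (sp F θ k (m + 1))) ∧
        (∀ m : ℕ, ∀ t ∈ D F θ k, ∀ old : OlderTerms (F.P k) (MatA N) θ.τ9.M m,
          (∀ (j : Fin (m + 1)) (Y : (domSys (F.P k) θ.τ9.M j).Dom), ∀ ψ ∈ sp F θ k j Y,
              ‖old j Y ψ‖ ≤ E_A * Real.exp (-(κ * (domSys (F.P k) θ.τ9.M j).dj Y))) →
          (∀ (j : Fin (m + 1)) (Y : (domSys (F.P k) θ.τ9.M j).Dom), AnalyticOnNhd ℂ (old j Y) (sp F θ k j Y)) →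
          (∀ Z : (domSys (F.P k) θ.τ9.M (m + 1)).Dom, AnalyticOnNhd ℂ (fun φ => (G F θ k m).H t old φ Z) (sp F θ k (m + 1) Z)) ∧
          (∀ (Z : (domSys (F.P k) θ.τ9.M (m + 1)).Dom), ∀ φ ∈ sp F θ k (m + 1) Z,
              ‖(G F θ k m).H t old φ Z‖ ≤ A_A * Real.exp (-(Rd * (domSys (F.P k) θ.τ9.M (m + 1)).dj Z)))) ∧
        0 ≤ A_A ∧ A_A * Real.exp (5 * κ + 1) * K₀ 64 8 * 9 * 64 < 1 ∧ Real.exp 1 * 9 * 64 * K₀ 64 8 ^ 2 * A_A ≤ E_A ∧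
        (∀ m, SpRestr (sp F θ (k + 1) (m + 1))) ∧
        (∀ m : ℕ, ∀ t ∈ D F θ k, ∀ old : OlderTerms (F.P (k + 1)) (MatA N) θ.τ9.M m,
          (∀ (j : Fin (m + 1)) (Y : (domSys (F.P (k + 1)) θ.τ9.M j).Dom), ∀ ψ ∈ sp F θ (k + 1) j Y,
              ‖old j Y ψ‖ ≤ E_B * Real.exp (-(κ * (domSys (F.P (k + 1)) θ.τ9.M j).dj Y))) →
          (∀ (j : Fin (m + 1)) (Y : (domSys (F.P (k + 1)) θ.τ9.M j).Dom), AnalyticOnNhd ℂ (old j Y) (sp F θ (k + 1) j Y)) →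
          (∀ Z : (domSys (F.P (k + 1)) θ.τ9.M (m + 1)).Dom, AnalyticOnNhd ℂ (fun φ => (G F θ (k + 1) m).H t old φ Z) (sp F θ (k + 1) (m + 1) Z)) ∧
          (∀ (Z : (domSys (F.P (k + 1)) θ.τ9.M (m + 1)).Dom), ∀ φ ∈ sp F θ (k + 1) (m + 1) Z,
              ‖(G F θ (k + 1) m).H t old φ Z‖ ≤ A_B * Real.exp (-(Rd * (domSys (F.P (k + 1)) θ.τ9.M (m + 1)).dj Z)))) ∧
        0 ≤ A_B ∧ A_B * Real.exp (5 * κ + 1) * K₀ 64 8 * 9 * 64 < 1 ∧ Real.exp 1 * 9 * 64 * K₀ 64 8 ^ 2 * A_B ≤ E_B ∧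
        (∀ s ∈ Ioc (0 : ℝ) γ', ((s : ℝ) : ℂ) ∈ D F θ k) ∧
        θ.γ ≤ γ' ∧ (li F θ).κ ≤ κ ∧ θ' ≤ (li F θ).θ₅ ∧
        (Real.exp 1 * 9 * 64 * K₀ 64 8 ^ 2 * (C3 * ε₁) / (1 - ρ₀) * (δ + δ') + B) * (θ' - ω) /
            (θ' - (ω + Real.exp 1 * 9 * 64 * K₀ 64 8 ^ 2 * (C3 * ε₁) / (1 - ρ₀) * cH)) ≤ (li F θ).C₅) :
    S_N18 (RRec₁₃CoPH 𝔯) :=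
  s_N18_rRec₁₃CoPH_of_forall_admissible_pin 𝔯 _ hpin fun F θ hP hA k =>
    n18At_u3OfRecord₁₃_readingAdm_toClusterTower_of_stepGen θ.toStage13Params k (G F θ) (D F θ k) (sp F θ) (gauge F θ) (hg F θ) (T₀ F θ) (hT F θ) (li F θ) (h F θ hP hA k)

include hpin in
open Classical in
/-- ★ **THE (GEN) ROW AT THE REGIME-RESTRICTED HOME — THE DATA ASKED ONLY OF THE TUPLES IN THE REGIME** [bookkeeping; §1 under the guard, layer B's
`s_N18_rRec₁₃CoPHOn_iff`]: the same as above with (i)–(ii) asked only at the admissible tuples with `Provisos₁₃CoPH` IN `Rg` ⟹ `S_N18 (RRec₁₃CoPHOn 𝔯 Rg)` — rev 16 ∕ 17's guarded binder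
at `Rg F θ := θ.ZhUnity F N ∧ θ.SlotsNondegenerate₁₃ F N`. [cite: Balaban1987RG1, (0.24)–(0.25) p.257, Thm 1 p.259 and (1.18) p.263; Balaban1988RG2Cluster, (2.13)–(2.14) pp.14–15 and Lemma 3 (2.38) p.20] -/
theorem s_N18_rRec₁₃CoPHOn_readingAdm_toClusterTower_of_stepGen_pin
    (h : ∀ (F : T4Family) (θ : Stage13HParams F N), θ.Provisos₁₃CoPH F N → Rg F θ → θ.Admissible F N → ∀ k : ℕ,
      ∃ (Op : Type) (_ : NormedAddCommGroup Op) (_ : NormedSpace ℂ Op) (Hist : Type) (_ : NormedAddCommGroup Hist) (_ : NormedSpace ℂ Hist)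
        (Mb : ℝ → StepModel (LevelPairing.ofRecordAdm F θ.τ9.M N k (sp F θ) (gauge F θ k) (hg F θ k) (T₀ F θ k) (hT F θ k)).carriers Op Hist)
        (act : ℝ → (j : ℕ) → Op × Hist → TDom 4 (domCount (F.P k) θ.τ9.M j) → ℂ) (γ' C3 ε₁ Rd κ A_A A_B E_A E_B E₁ δ δ' θr θ' cH ω ρ₀ B : ℝ)
        (k₀ : ℕ),
        (∀ b : ℝ, 0 < b → b ≤ γ' → ∀ (X : Node00.W1.Dom (F.P k) θ.τ9.M) (z : Op × Hist),
          (Mb b).Out X.1 z.1 z.2 X =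
            locE (TTouch (d := 4) (N := domCount (F.P k) θ.τ9.M X.1)) (fun Z : (tsys 4 (domCount (F.P k) θ.τ9.M X.1)).Dom => Z.1)
              (act b X.1 z) X.2.1) ∧
        0 ≤ C3 ∧ 0 ≤ ε₁ ∧ 0 ≤ κ ∧ κ + 2 * (64 * Real.log 162) + 2 ≤ Rd ∧
        C3 * ε₁ * Real.exp (5 * κ + 1) * K₀ 64 8 * 9 * 64 ≤ 1 ∧
        (∀ b : ℝ, 0 < b → b ≤ γ' → ∀ j, ∀ g ∈ Window γ',
          ∀ (U : (LevelPairing.ofRecordAdm F θ.τ9.M N k (sp F θ) (gauge F θ k) (hg F θ k) (T₀ F θ k) (hT F θ k)).BgB) (q : Op × Hist),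
          q ∈ (Mb b).Base j g U →
          ∃ V : Set (Op × Hist), IsOpen V ∧ (Mb b).box j q ⊆ V ∧
            (∀ Z : TDom 4 (domCount (F.P k) θ.τ9.M j), DifferentiableOn ℂ (fun z : Op × Hist => act b j z Z) V) ∧
            (∀ z ∈ V, ∀ Z : TDom 4 (domCount (F.P k) θ.τ9.M j), ‖act b j z Z‖ ≤ C3 * ε₁ * Real.exp (-(Rd * torusTreeLen Z.1)))) ∧
        (∀ b : ℝ, 0 < b → b ≤ γ' → L01 (Mb b)
          ((LevelPairing.ofRecordAdm F θ.τ9.M N k (sp F θ) (gauge F θ k) (hg F θ k) (T₀ F θ k) (hT F θ k)).EA (toClusterTower (G F θ k))) (Window γ')) ∧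
        (∀ b : ℝ, 0 < b → b ≤ γ' → L02 (Mb b)
          ((LevelPairing.ofRecordAdm F θ.τ9.M N k (sp F θ) (gauge F θ k) (hg F θ k) (T₀ F θ k) (hT F θ k)).EB (toClusterTower (G F θ (k + 1))) b)
          (Window γ')) ∧
        (∀ b : ℝ, 0 < b → b ≤ γ' → L03 (Mb b)
          ((LevelPairing.ofRecordAdm F θ.τ9.M N k (sp F θ) (gauge F θ k) (hg F θ k) (T₀ F θ k) (hT F θ k)).EB (toClusterTower (G F θ (k + 1))) b)
          (Window γ')) ∧
        (∀ b : ℝ, 0 < b → b ≤ γ' → L07 (Mb b) (Window γ') δ θr) ∧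
        (∀ b : ℝ, 0 < b → b ≤ γ' → L08 (Mb b) (Window γ') κ E_B δ' θr) ∧
        (∀ b : ℝ, 0 < b → b ≤ γ' → L09aff (Mb b) (Window γ')) ∧ (∀ b : ℝ, 0 < b → b ≤ γ' → L09blind (Mb b) (Window γ')) ∧
        (∀ b : ℝ, 0 < b → b ≤ γ' → L09hom (Mb b) (Window γ')) ∧ (∀ b : ℝ, 0 < b → b ≤ γ' → L09unit (Mb b) (Window γ') κ E₁ cH ω) ∧
        0 < E₁ ∧ 0 ≤ δ + δ' ∧ 0 ≤ θr ∧ θr ≤ θ' ∧ θ' ≤ 1 ∧ 0 ≤ cH ∧ 0 < ω ∧ ρ₀ < 1 ∧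
        (δ + δ') * θr ^ k₀ + cH * (E_A + E_B) / (1 - ω) ≤ ρ₀ ∧ 0 ≤ B ∧ (∀ k < k₀, E_A + E_B ≤ B * θr ^ k) ∧
        Real.exp 1 * 9 * 64 * K₀ 64 8 ^ 2 * C3 * cH * ε₁ < (θ' - ω) * (1 - ρ₀) ∧
        (∀ m, SpRestr (sp F θ k (m + 1))) ∧
        (∀ m : ℕ, ∀ t ∈ D F θ k, ∀ old : OlderTerms (F.P k) (MatA N) θ.τ9.M m,
          (∀ (j : Fin (m + 1)) (Y : (domSys (F.P k) θ.τ9.M j).Dom), ∀ ψ ∈ sp F θ k j Y,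
              ‖old j Y ψ‖ ≤ E_A * Real.exp (-(κ * (domSys (F.P k) θ.τ9.M j).dj Y))) →
          (∀ (j : Fin (m + 1)) (Y : (domSys (F.P k) θ.τ9.M j).Dom), AnalyticOnNhd ℂ (old j Y) (sp F θ k j Y)) →
          (∀ Z : (domSys (F.P k) θ.τ9.M (m + 1)).Dom, AnalyticOnNhd ℂ (fun φ => (G F θ k m).H t old φ Z) (sp F θ k (m + 1) Z)) ∧
          (∀ (Z : (domSys (F.P k) θ.τ9.M (m + 1)).Dom), ∀ φ ∈ sp F θ k (m + 1) Z,
              ‖(G F θ k m).H t old φ Z‖ ≤ A_A * Real.exp (-(Rd * (domSys (F.P k) θ.τ9.M (m + 1)).dj Z)))) ∧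
        0 ≤ A_A ∧ A_A * Real.exp (5 * κ + 1) * K₀ 64 8 * 9 * 64 < 1 ∧ Real.exp 1 * 9 * 64 * K₀ 64 8 ^ 2 * A_A ≤ E_A ∧
        (∀ m, SpRestr (sp F θ (k + 1) (m + 1))) ∧
        (∀ m : ℕ, ∀ t ∈ D F θ k, ∀ old : OlderTerms (F.P (k + 1)) (MatA N) θ.τ9.M m,
          (∀ (j : Fin (m + 1)) (Y : (domSys (F.P (k + 1)) θ.τ9.M j).Dom), ∀ ψ ∈ sp F θ (k + 1) j Y,
              ‖old j Y ψ‖ ≤ E_B * Real.exp (-(κ * (domSys (F.P (k + 1)) θ.τ9.M j).dj Y))) →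
          (∀ (j : Fin (m + 1)) (Y : (domSys (F.P (k + 1)) θ.τ9.M j).Dom), AnalyticOnNhd ℂ (old j Y) (sp F θ (k + 1) j Y)) →
          (∀ Z : (domSys (F.P (k + 1)) θ.τ9.M (m + 1)).Dom, AnalyticOnNhd ℂ (fun φ => (G F θ (k + 1) m).H t old φ Z) (sp F θ (k + 1) (m + 1) Z)) ∧
          (∀ (Z : (domSys (F.P (k + 1)) θ.τ9.M (m + 1)).Dom), ∀ φ ∈ sp F θ (k + 1) (m + 1) Z,
              ‖(G F θ (k + 1) m).H t old φ Z‖ ≤ A_B * Real.exp (-(Rd * (domSys (F.P (k + 1)) θ.τ9.M (m + 1)).dj Z)))) ∧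
        0 ≤ A_B ∧ A_B * Real.exp (5 * κ + 1) * K₀ 64 8 * 9 * 64 < 1 ∧ Real.exp 1 * 9 * 64 * K₀ 64 8 ^ 2 * A_B ≤ E_B ∧
        (∀ s ∈ Ioc (0 : ℝ) γ', ((s : ℝ) : ℂ) ∈ D F θ k) ∧
        θ.γ ≤ γ' ∧ (li F θ).κ ≤ κ ∧ θ' ≤ (li F θ).θ₅ ∧
        (Real.exp 1 * 9 * 64 * K₀ 64 8 ^ 2 * (C3 * ε₁) / (1 - ρ₀) * (δ + δ') + B) * (θ' - ω) /
            (θ' - (ω + Real.exp 1 * 9 * 64 * K₀ 64 8 ^ 2 * (C3 * ε₁) / (1 - ρ₀) * cH)) ≤ (li F θ).C₅) :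
    S_N18 (RRec₁₃CoPHOn 𝔯 Rg) := by
  rw [s_N18_rRec₁₃CoPHOn_iff]
  intro F θ hP hRg hA g₀ os k
  rw [hpin]
  exact n18At_u3OfRecord₁₃_readingAdm_toClusterTower_of_stepGen θ.toStage13Params k (G F θ) (D F θ k) (sp F θ) (gauge F θ) (hg F θ) (T₀ F θ) (hT F θ) (li F θ)
    (h F θ hP hRg hA k)

end Record

end YMDAG.N18.W1Reading

end
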